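import Literature.AnabelianGeometry.SemiGraphs.TemperedFunctorialityHomClause1
import Literature.AnabelianGeometry.SemiGraphs.SubdivisionLemmas
import HarnessLib

/-!
# The DOUBLE of a semi-graph of anabelioids along a branch

Mochizuki, *Semi-graphs of anabelioids*, Publ. RIMS **42** (2006), §1 p. 11 (semi-graphs), §2 Def. 2.1–2.4
pp. 22–26 (semi-graphs of anabelioids and their adjectives), §3 Definition 3.8 / Corollary 3.9 p. 42
[cite: MochizukiSemiAnbd2006, Cor 3.9 p.42].

Toolkit of the abc-iut cell (layer L3, F wave seat abc-iut-f-175) for the LITERAL reading of Def. 3.8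
(the tree's frozen `IsQuasiGeometric`; cell finding t2g2-F1 / ruling χ2: "the fold homomorphism
`Π_{v₁} *_{Π_e} Π_{v₂} → Π_w ⊂ π₁^temp(H)` (two copies of one vertex glued along one branch, folded onto
that vertex) is quasi-geometric but is induced by NO morphism of semi-graphs").  Given a semi-graph of
anabelioids `𝒢` (local presentation), a vertex `w` and a branch `b` abutting to `w`:

* `SemiGraph.segment` — the graph `v₀ —— v₁` (two vertices, one edge, each branch abutting to the
  vertex of the same name);
* `ProfiniteSemiGraph.double 𝒢 h` — the DOUBLE of `𝒢` along `b`: the segment with both vertex groups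
  `Π_w`, edge group `Π_e` (`e` the edge of `b`) and both branch homomorphisms `b_*`; its elementary
  properties are those of `𝒢` at `w` / `b`: `double_isOfInjectiveType`, `double_isVerticiallySlim`,
  `double_isTotallyAloof` / `double_isTotallyEstranged` (each vertex of the segment carries ONE branch,
  so only the clause "`b' = b`, `g ∉ Π_b`" of Def. 2.4 (iv) occurs), `double_isTotallyElevated` via the
  restricted approximators `Approximator.double`.

Sequel (`TemperedBranchDoubleFold.lean`): the fold functor `B^cov(𝒢) ⥤ B^cov(double)` and its representing
homomorphism `π₁^temp(double) → π₁^temp(𝒢)`.  Consumer: the refutation of the literal `Cor39` /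
`QuasiGeometricGraphData` (FACT-LIST row F-1710) at the double of the estranged loop of
`WitnessIwahoriLoop`.  Nothing here takes a side on [IUTchIII] Cor. 3.12; no statement of the paper is
asserted.
-/

noncomputable section

open CategoryTheory CategoryTheory.Limits Topology

namespace Literature.AnabelianGeometry.SemiGraphs

open Literature.AlgebraicGeometry.Frobenioids (IsSlimGroup)

universe u

/-! ### The segment `v₀ —— v₁` -/

namespace SemiGraph

/-- The SEGMENT: two vertices `v₀, v₁`, one edge, its two branches abutting to `v₀` and `v₁`
respectively (the graph with "precisely two vertices joined by a single closed edge", [SemiAnbd] §1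
p. 11).  Reducible, so that `segment.Vertex` unfolds to `ULift Bool` for instance resolution.
[cite: MochizukiSemiAnbd2006, §1 p.11] -/
@[reducible] def segment : SemiGraph.{u} where
  Vertex := ULift Bool
  Edge := PUnit
  Branch := ULift Bool
  edgeOf _ := PUnit.unit
  abuts b := some b
  two_branches e := by
    refine ⟨⟨false⟩, ⟨true⟩, fun h => ?_, Subsingleton.elim _ _, Subsingleton.elim _ _, fun b _ => ?_⟩
    · cases h
    · rcases b with ⟨_ | _⟩
      · exact Or.inl rfl
      · exact Or.inr rfl

/-- The segment is a graph: every branch abuts. [cite: MochizukiSemiAnbd2006, §1 p.11] -/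
theorem segment_isGraph : segment.{u}.IsGraph := ⟨fun _ => rfl⟩

/-- The segment is countable. [cite: MochizukiSemiAnbd2006, §1 p.11] -/
theorem segment_isCountable : segment.{u}.IsCountable :=
  ⟨inferInstanceAs (Countable (ULift Bool)), inferInstanceAs (Countable PUnit)⟩

/-- The segment is connected: every node of its barycentric subdivision is joined to the midpoint of
the edge. [cite: MochizukiSemiAnbd2006, §1 p.11] -/
theorem segment_isConnected : segment.{u}.IsConnected := by
  classical
  set G := segment.{u}
  have hbe : ∀ b : G.Branch, G.subdivision.Reachable (Sum.inr (Sum.inr b)) (Sum.inr (Sum.inl PUnit.unit)) :=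
    fun b => (subdivision_adj_of_nodeRel G (NodeRel.edge_branch b)).reachable.symm
  have hall : ∀ a : G.Node, G.subdivision.Reachable a (Sum.inr (Sum.inl PUnit.unit)) := by
    intro a
    rcases a with v | ⟨⟨⟩⟩ | b
    · exact (subdivision_adj_of_nodeRel G (NodeRel.branch_vertex (v : G.Branch) v rfl)).reachable.symm.trans
        (hbe v)
    · exact SimpleGraph.Reachable.refl _
    · exact hbe b
  haveI : Nonempty G.Node := ⟨Sum.inr (Sum.inl PUnit.unit)⟩
  exact ⟨⟨fun a b => (hall a).trans (hall b).symm⟩⟩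

/-- In the segment, the branch abutting to a vertex is unique. [cite: MochizukiSemiAnbd2006, §1 p.11] -/
theorem segment_branch_eq_of_abuts {b : segment.{u}.Branch} {v : segment.{u}.Vertex}
    (h : segment.{u}.abuts b = some v) : b = v :=
  Option.some.inj h

end SemiGraph

namespace ProfiniteSemiGraph

variable (𝒢 : ProfiniteSemiGraph.{u}) {b : 𝒢.graph.Branch} {w : 𝒢.graph.Vertex}
  (h : 𝒢.graph.abuts b = some w)

/-! ### The double of `𝒢` along the branch `b` at `w` -/

/-- **The DOUBLE of `𝒢` along the branch `b` abutting to `w`**: the segment `v₀ —— v₁` with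
`Π_{v₀} = Π_{v₁} := Π_w`, `Π_e := Π_{e(b)}` and both branch homomorphisms `b_*` (two copies of the
vertex `w` glued along the branch `b`; the source of the "fold", finding t2g2-F1).  Reducible (as
`CovObj.coveringGraph`), so that `B^temp(Π_{v_i})` unfolds to `B^temp(Π_w)` for instance resolution.
[cite: MochizukiSemiAnbd2006, Def 2.1 p.22] -/
@[reducible] def double : ProfiniteSemiGraph.{u} where
  graph := SemiGraph.segment
  Gv _ := 𝒢.Gv w
  Ge _ := 𝒢.Ge (𝒢.graph.edgeOf b)
  brHom _ _ _ := 𝒢.brHom b w h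

/-- The branch homomorphisms of the double are `b_*`. [cite: MochizukiSemiAnbd2006, Def 2.1 p.22] -/
@[simp] theorem double_brHom (β : (𝒢.double h).graph.Branch) (v : (𝒢.double h).graph.Vertex)
    (hv : (𝒢.double h).graph.abuts β = some v) : (𝒢.double h).brHom β v hv = 𝒢.brHom b w h := rfl

/-- The branch subgroups of the double are `Π_b ⊆ Π_w`. [cite: MochizukiSemiAnbd2006, §2 p.23] -/
theorem double_branchSubgroup (β : (𝒢.double h).graph.Branch) (v : (𝒢.double h).graph.Vertex)
    (hv : (𝒢.double h).graph.abuts β = some v) :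
    (𝒢.double h).branchSubgroup β v hv = 𝒢.branchSubgroup b w h := rfl

/-- The double is a graph. [cite: MochizukiSemiAnbd2006, §1 p.11] -/
theorem double_isGraph : (𝒢.double h).IsGraph := SemiGraph.segment_isGraph

/-- The double has a vertex. [cite: MochizukiSemiAnbd2006, Thm 3.7 p.40] -/
theorem double_hasVertex : (𝒢.double h).HasVertex := ⟨⟨true⟩⟩

/-- The double is countable. [cite: MochizukiSemiAnbd2006, §1 p.11] -/
theorem double_isCountable : (𝒢.double h).IsCountable := SemiGraph.segment_isCountable

/-- The double is connected. [cite: MochizukiSemiAnbd2006, §1 p.11] -/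
theorem double_isConnected : (𝒢.double h).IsConnected := SemiGraph.segment_isConnected

/-- The double is finite: finitely many vertices. [cite: MochizukiSemiAnbd2006, §1 p.11] -/
instance double_finite_vertex : Finite (𝒢.double h).graph.Vertex := inferInstanceAs (Finite (ULift Bool))

/-- The double is finite: finitely many edges. [cite: MochizukiSemiAnbd2006, §1 p.11] -/
instance double_finite_edge : Finite (𝒢.double h).graph.Edge := inferInstanceAs (Finite PUnit)

/-- The double is of injective type if `b_*` is injective. [cite: MochizukiSemiAnbd2006, Def 2.1 p.22] -/
theorem double_isOfInjectiveType (hinj : Function.Injective (𝒢.brHom b w h)) :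
    (𝒢.double h).IsOfInjectiveType := fun _ _ _ => hinj

/-- The double is verticially slim if `Π_w` is slim. [cite: MochizukiSemiAnbd2006, Def 2.4(ii) p.25] -/
theorem double_isVerticiallySlim (hs : IsSlimGroup (𝒢.Gv w)) : (𝒢.double h).IsVerticiallySlim :=
  fun _ => hs

/-- The double is totally aloof if the edge of `b` is aloof in `𝒢`: each vertex of the segment carries
ONE branch, so only the clause "`b' = b` and `g ∉ Π_b`" of Def. 2.4 (iv) occurs, and it is that clause
for `b` at `w`. [cite: MochizukiSemiAnbd2006, Def 2.4(iv) p.26] -/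
theorem double_isTotallyAloof (ha : 𝒢.IsAloofEdge (𝒢.graph.edgeOf b)) : (𝒢.double h).IsTotallyAloof := by
  intro e β _ v hv β' hv' g hg
  have hβ : β = v := SemiGraph.segment_branch_eq_of_abuts hv
  have hβ' : β' = v := SemiGraph.segment_branch_eq_of_abuts hv'
  have hg' : g ∉ 𝒢.branchSubgroup b w h := by
    rcases hg with hne | hg
    · exact absurd (hβ'.trans hβ.symm) hne
    · exact hg
  exact ha b rfl w h b h g (Or.inr hg')

/-- The double is totally estranged if the edge of `b` is estranged in `𝒢` (same reduction to the
clause "`b' = b`, `g ∉ Π_b`"). [cite: MochizukiSemiAnbd2006, Def 2.4(iv) p.26] -/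
theorem double_isTotallyEstranged (he : 𝒢.IsEstrangedEdge (𝒢.graph.edgeOf b)) :
    (𝒢.double h).IsTotallyEstranged := by
  intro e
  refine ⟨𝒢.double_isTotallyAloof h he.1 e, ?_⟩
  intro β _ v hv β' hv' g hg
  have hβ : β = v := SemiGraph.segment_branch_eq_of_abuts hv
  have hβ' : β' = v := SemiGraph.segment_branch_eq_of_abuts hv'
  have hg' : g ∉ 𝒢.branchSubgroup b w h := by
    rcases hg with hne | hg
    · exact absurd (hβ'.trans hβ.symm) hne
    · exact hg
  exact he.2 b rfl w h b h g (Or.inr hg')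

variable {𝒢} in
/-- An approximator of `𝒢` restricts to an approximator of the double: the finite quotients of `Π_w`
and `Π_e` with the branch map of `b` on both sides. [cite: MochizukiSemiAnbd2006, Def 2.3 pp.24-25] -/
def Approximator.double (A : 𝒢.Approximator) : (𝒢.double h).Approximator where
  FV _ := A.FV w
  FE _ := A.FE (𝒢.graph.edgeOf b)
  πV _ := A.πV w
  πE _ := A.πE (𝒢.graph.edgeOf b)
  isOpen_ker_πV _ := A.isOpen_ker_πV w
  isOpen_ker_πE _ := A.isOpen_ker_πE (𝒢.graph.edgeOf b)
  brF _ _ _ := A.brF b w h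
  brF_injective _ _ _ := A.brF_injective b w h
  comm _ _ _ := A.comm b w h
  bounded := by
    obtain ⟨M, hM, hd⟩ := A.bounded
    exact ⟨M, hM, fun _ => hd w⟩

variable {𝒢} in
/-- A `π₁`-epimorphic approximator restricts to a `π₁`-epimorphic one. [cite: MochizukiSemiAnbd2006, Def 2.3(ii) p.25] -/
theorem Approximator.double_isPiOneEpimorphic {A : 𝒢.Approximator} (hA : A.IsPiOneEpimorphic) :
    (A.double h).IsPiOneEpimorphic :=
  ⟨fun _ => hA.1 w, fun _ => hA.2 _⟩

/-- The double is totally elevated if `w` is an elevated vertex of `𝒢` (the subgroup `N_M` avoiding the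
conjugates of ALL branch images at `w` avoids those of `b_*`).
[cite: MochizukiSemiAnbd2006, Def 2.4(i) p.25] -/
theorem double_isTotallyElevated (hel : 𝒢.IsElevatedVertex w) : (𝒢.double h).IsTotallyElevated := by
  intro v M
  obtain ⟨A, hA, N, hN, hNb⟩ := hel M
  exact ⟨A.double h, Approximator.double_isPiOneEpimorphic h hA, N, hN, fun β hβ g => hNb b h g⟩

end ProfiniteSemiGraph

end Literature.AnabelianGeometry.SemiGraphs

end
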